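import Mathlib
import HarnessLib
import Summits.KontsevichZagierPeriods.KontsevichZagierPeriods.Theses.Neg
import Literature.NumberTheory.Transcendental.KZProductIdeal
import Literature.NumberTheory.Transcendental.KZCubeProducts
import Literature.NumberTheory.Transcendental.KZDirichletScaling

/-!
# Birth skeleton of the split child `DasSquareAccessible` (crux CancellationGap, route Neg)

Two registered-style stubs and the kernel-checked composition `DasSquareAccessible_of`, cutting the
division-free standard certificate of the squared level-12 Deligne–Koblitz–Ogus identity
(DasInstance.md §3, reordered) at its natural intermediate representation

  `M = [(0,1)⁴, 2^{7/6}·3^{-1/4} · ∏_{j<4} t_j^{x_j-1}(1-t_j)^{y_j-1}]`, `x = (1/12,1/6,1/4,1/2)`,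
  `y = (11/12,5/6,3/4,1/2)` (value `2^{7/6}3^{-1/4}·B(1/12,11/12)B(1/6,5/6)B(1/4,3/4)B(1/2,1/2) = α²π⁴`):

* `stub_multiplicationSteps` : `r.prod r ∼ M` — the three multiplication-type steps (pure-Beta Legendre at
  `y = 1/3` and `y = 1/12`, pure-Beta Gauss triplication at `1/4` backwards), Γ-multisets
  `{1,1,4,4,9,9,10,10} → {1,2,3,6,6,9,10,11}·2^{7/6}3^{-1/4}`, tensored inside the 6-fold product and
  re-associated (KZCubeProducts / KZDirichletPeeling / KZGaussMultiplicationChain bookkeeping);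
* `stub_reflectionSteps` : `M ∼ r'.prod r'` — the three reflection values `B(a,1-a) ∼ (1/sin πa)·B(½,½)` at
  `a = 1/12, 1/6, 1/4` (instances of item 3383 `EulerReflectionRational`), scalars
  `(√6+√2)·2·√2·2^{7/6}3^{-1/4} = α²`, and the packaging of `r'.prod r'` as `α²·B(½,½)⁴·B(1,1)²`.

The composition only needs the EXISTENCE of a pinned `M` (`KZ.exists_cubeBetaRep` + `KZ.IntegralRep.constMul`,
the constant being real algebraic: `KZ.isAlgebraic_natCast_rpow_ratCast`) and transitivity.
-/

noncomputable section

namespace Summit.KontsevichZagierPeriods.KontsevichZagierPeriods.Cruxes.CancellationGap.DasSquareBirth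

open MeasureTheory Set
open Literature.NumberTheory.Transcendental Literature.NumberTheory.Transcendental.KZ

/-- STUB (multiplication-type steps): the Fubini square of the Das representation is move-equivalent to the
pinned 4-dimensional intermediate `M` (two pure-Beta Legendre duplications, one pure-Beta Gauss triplication
backwards, re-association of Beta chains). [folklore] -/
theorem stub_multiplicationSteps :
    ∀ (r : Literature.NumberTheory.Transcendental.KZ.IntegralRep 3)
      (M : Literature.NumberTheory.Transcendental.KZ.IntegralRep 4),
      r.domain = {t | ∀ j, t j ∈ Set.Ioo (0:ℝ) 1} →
      Set.EqOn r.integrand (fun t => ∏ j, t j ^ (((![(1:ℚ)/12, 5/12, 7/6] : Fin 3 → ℚ) j : ℝ) - 1) *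
        (1 - t j) ^ (((![(1:ℚ)/3, 3/4, 5/6] : Fin 3 → ℚ) j : ℝ) - 1)) r.domain →
      M.domain = {t | ∀ j, t j ∈ Set.Ioo (0:ℝ) 1} →
      Set.EqOn M.integrand (fun t => (2:ℝ) ^ ((7:ℝ)/6) * (3:ℝ) ^ (-(1:ℝ)/4) *
        ∏ j, t j ^ (((![(1:ℚ)/12, 1/6, 1/4, 1/2] : Fin 4 → ℚ) j : ℝ) - 1) *
          (1 - t j) ^ (((![(11:ℚ)/12, 5/6, 3/4, 1/2] : Fin 4 → ℚ) j : ℝ) - 1)) M.domain →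
      Literature.NumberTheory.Transcendental.KZ.Equivalent (r.prod r) M := by
  sorry

/-- STUB (reflection steps): the pinned intermediate `M` is move-equivalent to the Fubini square of the
`α`-arcsine representation (three reflection values at `1/12, 1/6, 1/4` and Beta packaging). [folklore] -/
theorem stub_reflectionSteps :
    ∀ (M : Literature.NumberTheory.Transcendental.KZ.IntegralRep 4)
      (r' : Literature.NumberTheory.Transcendental.KZ.IntegralRep 3),
      M.domain = {t | ∀ j, t j ∈ Set.Ioo (0:ℝ) 1} →
      Set.EqOn M.integrand (fun t => (2:ℝ) ^ ((7:ℝ)/6) * (3:ℝ) ^ (-(1:ℝ)/4) *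
        ∏ j, t j ^ (((![(1:ℚ)/12, 1/6, 1/4, 1/2] : Fin 4 → ℚ) j : ℝ) - 1) *
          (1 - t j) ^ (((![(11:ℚ)/12, 5/6, 3/4, 1/2] : Fin 4 → ℚ) j : ℝ) - 1)) M.domain →
      r'.domain = {t | ∀ j, t j ∈ Set.Ioo (0:ℝ) 1} →
      Set.EqOn r'.integrand (fun t => (2:ℝ) ^ ((19:ℝ)/12) * (3:ℝ) ^ (-(1:ℝ)/8) * Real.sqrt (1 + Real.sqrt 3) *
        ∏ j, t j ^ (((![(1:ℚ)/2, 1/2, 1] : Fin 3 → ℚ) j : ℝ) - 1) *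
          (1 - t j) ^ (((![(1:ℚ)/2, 1/2, 1] : Fin 3 → ℚ) j : ℝ) - 1)) r'.domain →
      Literature.NumberTheory.Transcendental.KZ.Equivalent M (r'.prod r') := by
  sorry

/-- The scaling constant `2^{7/6}·3^{-1/4}` of the intermediate representation is real algebraic.
[folklore] -/
theorem isAlgebraic_intermediateConst :
    IsAlgebraic ℚ ((2:ℝ) ^ ((7:ℝ)/6) * (3:ℝ) ^ (-(1:ℝ)/4)) := by
  have h2 := KZ.isAlgebraic_natCast_rpow_ratCast 2 (7/6)
  have h3 := KZ.isAlgebraic_natCast_rpow_ratCast 3 (-1/4)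
  have e2 : ((2:ℕ) : ℝ) ^ (((7/6 : ℚ)) : ℝ) = (2:ℝ) ^ ((7:ℝ)/6) := by norm_num
  have e3 : ((3:ℕ) : ℝ) ^ (((-1/4 : ℚ)) : ℝ) = (3:ℝ) ^ (-(1:ℝ)/4) := by norm_num
  rw [e2] at h2
  rw [e3] at h3
  exact h2.mul h3

/-- A pinned intermediate representation `M` exists (cube Beta representation of the data
`x = (1/12,1/6,1/4,1/2)`, `y = (11/12,5/6,3/4,1/2)`, scaled by the algebraic constant `2^{7/6}3^{-1/4}`).
[folklore] -/
theorem exists_intermediate :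
    ∃ M : Literature.NumberTheory.Transcendental.KZ.IntegralRep 4,
      M.domain = {t | ∀ j, t j ∈ Set.Ioo (0:ℝ) 1} ∧
      Set.EqOn M.integrand (fun t => (2:ℝ) ^ ((7:ℝ)/6) * (3:ℝ) ^ (-(1:ℝ)/4) *
        ∏ j, t j ^ (((![(1:ℚ)/12, 1/6, 1/4, 1/2] : Fin 4 → ℚ) j : ℝ) - 1) *
          (1 - t j) ^ (((![(11:ℚ)/12, 5/6, 3/4, 1/2] : Fin 4 → ℚ) j : ℝ) - 1)) M.domain := by
  obtain ⟨R, hRd, hRi⟩ := KZ.exists_cubeBetaRep (![(1:ℚ)/12, 1/6, 1/4, 1/2] : Fin 4 → ℚ)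
    (![(11:ℚ)/12, 5/6, 3/4, 1/2] : Fin 4 → ℚ) (fun j => by fin_cases j <;> norm_num)
  refine ⟨R.constMul _ isAlgebraic_intermediateConst, by rw [IntegralRep.domain_constMul, hRd], ?_⟩
  intro t ht
  rw [IntegralRep.domain_constMul] at ht
  show (2:ℝ) ^ ((7:ℝ)/6) * (3:ℝ) ^ (-(1:ℝ)/4) * R.integrand t = _
  rw [hRi ht]

/-- **Composition**: the split child `DasSquareAccessible` (verbatim) from the two stubs, through the pinned
intermediate representation and transitivity of `KZ.Equivalent`. [folklore] -/
theorem DasSquareAccessible_of :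
    ∀ (r r' : Literature.NumberTheory.Transcendental.KZ.IntegralRep 3), r.domain = {t | ∀ j, t j ∈ Set.Ioo (0:ℝ) 1} → Set.EqOn r.integrand (fun t => ∏ j, t j ^ (((![(1:ℚ)/12, 5/12, 7/6] : Fin 3 → ℚ) j : ℝ) - 1) * (1 - t j) ^ (((![(1:ℚ)/3, 3/4, 5/6] : Fin 3 → ℚ) j : ℝ) - 1)) r.domain → r'.domain = {t | ∀ j, t j ∈ Set.Ioo (0:ℝ) 1} → Set.EqOn r'.integrand (fun t => (2:ℝ) ^ ((19:ℝ)/12) * (3:ℝ) ^ (-(1:ℝ)/8) * Real.sqrt (1 + Real.sqrt 3) * ∏ j, t j ^ (((![(1:ℚ)/2, 1/2, 1] : Fin 3 → ℚ) j : ℝ) - 1) * (1 - t j) ^ (((![(1:ℚ)/2, 1/2, 1] : Fin 3 → ℚ) j : ℝ) - 1)) r'.domain → Literature.NumberTheory.Transcendental.KZ.Equivalent (r.prod r) (r'.prod r') := by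
  intro r r' hrd hri hr'd hr'i
  obtain ⟨M, hMd, hMi⟩ := exists_intermediate
  exact (stub_multiplicationSteps r M hrd hri hMd hMi).trans (stub_reflectionSteps M r' hMd hMi hr'd hr'i)

end Summit.KontsevichZagierPeriods.KontsevichZagierPeriods.Cruxes.CancellationGap.DasSquareBirth

end
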